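import Summits.QuantumFields.BalabanUV.Beta.EriceFlowEnclosureB12AsPrintedPointwiseUniform
import Literature.MathematicalPhysics.QuantumFieldTheory.Balaban1983to89.FlowStepRuns

/-!
# Beta / EriceFlowEnclosureB12AsPrintedPointwiseCover — WHAT (0.31) FORCES POINTWISE, part 5: THE HISTORY READING.  Coverage of a punctured
# neighbourhood of zero coupling by tuned runs needs NEITHER the Markov letter NOR injective one-step maps: Theorem 2 at K = k, ONE MORE STEP of
# (0.20)'s forward determination (the extension is again a row of the coupling table), and LOCAL uniqueness of the in-interval run near zero; a
# COUPLING-CHART bound on the oscillation of β_{k+1} in the PRECEDING couplings then spreads the window bound from the run curve over the box: the AF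
# letter from the g-uniform Theorem 2 in the history reading (β-flow team, prover 2 = lower ∕ positivity side, unit `b2b-balaban-beta-bflow-p2`, gen 43;
# ROW AP-I × ROW U; answers gen 42's question «a sign-free history modulus under which Theorem 2 forces positivity on a NEIGHBOURHOOD of the run
# curve?»; parts 1∕2 = the Markov reading with injectivity; part 4 = the two-coupling toy; part 6 `…PointwiseFading` discharges local uniqueness
# SIGN-FREE from prover 1's fading-memory moduli and Theorem 2's own (0.31))

HONEST FRAMING (page 1 of everything the β sub-cell writes): discharging `BetaPertH` makes Bałaban's UV stability UNCONDITIONAL — a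
real constructive-QFT result; it is NOT the continuum limit and NOT the Clay problem.  HONEST DEPENDENCY (cell reorg 2026-08-19,
verbatim): «continuum YM on T⁴ ⇐ BetaPertH ∧ nine spine estimates (0/9 proved); BetaPertH ⇐ (D1) ∧ (D4) ∧ CAP+tail; G-an2-4 gates
asym, D1 and NE2/3/4.»  THIS MODULE DISCHARGES NOTHING: bookkeeping from the NAMED FIELDS of the statement-exact typing of [I] =
T. Bałaban, Commun. Math. Phys. **109** (1987) [Balaban1987RG1] (`B12BetaAsPrinted`: `Definitions.d018 ∕ d020` — (0.18)∕(0.20) pp. 255–256 —, the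
tuned-run form of `Theorem2Statement` — Theorem 2 is STATED WITHOUT PROOF in print, p. 259; [Balaban1989LargeFieldII] p. 355 «has not been published
yet») under LETTERS that are HYPOTHESES on an abstract `Setting S`: prover 1's binder `hrg` (inside a box the couplings obey (0.20) at their own
histories; dischargeable from (U) by `…TunedUpper.hrg_of_betaUpperH`), an upper bound (U) `BetaUpperH M γ_U`, LOCAL UNIQUENESS of the in-interval run
inside a small box ]0, g₂] («g₀ = g₀(ε, g)» read as a function NEAR ZERO — an UNPRINTED reading, DELTA-I D-21; row U), and the oscillation letter `hosc`
(|β_{k+1}(p) − β_{k+1}(q)| ≤ Λδ for histories p, q ∈ ]0, δ]^{k+1} with the same LAST coupling — UNPRINTED; [I] p. 298 only says β_{j} *"depends also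
on all preceding coupling constants"*).  Nothing of Bałaban's objects is asserted.

THE POINT.  Part 1 pinned β_{k+1}(x) through ONE tuned run of length k + 1 whose step-k coupling is x, found by INVERTING the Markov one-step level
map (injectivity, row U's Cγ³ < 2).  In the history reading (p. 298) there is no level map — but none is needed: Theorem 2 at K = k gives the tuned run
r(x) of length k ENDING at x; (0.31) along it puts its earlier couplings BELOW x; `d020` extends it by one step to an endpoint g with 1∕g² = 1∕x² −
β_{k+1}(r(x)_{<k}, x) ≥ 1∕g₂² once 1∕x² ≥ 1∕g₂² + M⁺, and forward uniqueness (`FlowStepRuns.flow_eq_of_rgEqH`, `d018`) makes the extension THE ROW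
(k + 1, m, g₀(x)) (§1).  It lies in ]0, g₂]; local uniqueness identifies it with the tuned run ending at g, and (0.31) on its last window gives
`β(g) ln L ≤ β_{k+1}(r(x)_{<k}, x) ≤ β′(g) ln L` (§2): POSITIVITY ALONG THE RUN CURVE, WHOSE LAST-COORDINATE PROJECTION IS A PUNCTURED NEIGHBOURHOOD
OF ZERO, earlier coordinates below the last.  A box history (h, x) ∈ ]0, δ]^{k+1} differs from (r(x)_{<k}, x) only in the preceding couplings, inside
]0, δ]: an oscillation bound Λδ in the COUPLING chart moves the window bound to (h, x) at the price ∓Λδ, and δ ↓ 0 costs nothing on the (0.31) side (§3)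
— so with g-UNIFORM constants THE AF LETTER follows (§4); the Markov letter is the case Λ = 0, with parts 1∕2's injectivity weakened to local uniqueness.
Part 4's two-coupling toy has every other letter of §4 and β_2 = −½ in every box: its history dependence does not fade at zero coupling (part 6).

WHAT THIS FILE PROVES (0 sorry, 0 def):
§1 **`extend_run`** — `Definitions` ⟹ a positive solution of (0.20) up to k, extended by one positive solution step, is the table row (k + 1, m, g₀).
§2 **`cover_step`** (CORE: Theorem 2's tuned runs at interval γ for endpoints ≤ g₁ with constants B₁(g) ≥ 0, B₂(g); `hrg`, (U) on ]0, γ_U]; local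
   uniqueness in ]0, g₂], g₂ ≤ min(g₁, γ); then for every k and every x ∈ ]0, g₂] with 1∕x² ≥ 1∕g₂² + M⁺ there is a row (k + 1, m, g₀) through
   g_k = x, earlier couplings in ]0, x], inside ]0, g₂], endpoint g ≤ g₂, with `B₁ g ≤ β_{k+1}(g₀, …, g_{k−1}, x) ≤ B₂ g`), **`cover`** (threshold form:
   ∃ x₁ > 0 for all k and all x ≤ x₁), `cover_of_theorem2Statement` (the typed Theorem 2: constants at the endpoint, via `Classical.choose`).
§3 **`letters_of_cover_histOsc`** (coverage with uniform [b, b′] + `hosc` ⟹ `BetaLowerH (b − Λδ) δ ∧ BetaUpperH (b′ + Λδ) δ`, every δ ≤ x₁).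
§4 **`letters_of_uniformTheorem2_unique_histOsc`**, **`betaAFH_of_uniformTheorem2_unique_histOsc`** (g-uniform Theorem 2 + `Definitions` + (U) + `hrg` +
   local uniqueness + `hosc` ⟹ `BetaAFH S.β`), `histOsc_of_markov` (Markov ⟹ `hosc` with Λ = 0), **`letters_of_uniformTheorem2_unique_markov`** (part 2's
   `letters_of_uniformTheorem2_markov` with injectivity weakened to local uniqueness), **`betaSignH_of_theorem2_unique_markov`** (part 1's
   `betaSignH_of_theorem2_markov`, same weakening; typed Theorem 2).
NOT CLAIMED: uniqueness, `hosc`, any modulus, sign or bound for Bałaban's β; Theorem 2; `BetaPertH`; continuum; Clay.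
-/

namespace Summit.QuantumFields.BalabanUV.Beta.EriceFlowEnclosureB12AsPrintedPointwiseCover

open Literature.MathematicalPhysics.QuantumFieldTheory.Balaban1983to89
open Literature.MathematicalPhysics.QuantumFieldTheory.Balaban1983to89.B12BetaAsPrinted
open Literature.MathematicalPhysics.QuantumFieldTheory.Balaban1983to89.FlowStep (prefixOf Box mem_box box_mono BetaLowerH BetaUpperH
  BetaSignH BetaAFH RGEqH)
open Summit.QuantumFields.BalabanUV.Beta.EriceFlowEnclosureB12AsPrintedUpper (tunedRuns_of_theorem2Statement)
open Summit.QuantumFields.BalabanUV.Beta.EriceFlowEnclosureB12AsPrintedTunedUpper (prefixOf_mem_box_of_inInterval)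

noncomputable section

variable {S : Setting}

/-! ## §1 One more step: a positive solution of (0.20) extended by one step is a row of the coupling table -/

/-- **ONE-STEP EXTENSION IS A TABLE ROW.**  Under the printed `Definitions` ((0.18) `d018`: the row (K, m, g₀) starts at g₀; (0.20) `d020`: forward
determination by the positive solution), if `gs` solves (0.20) up to step k with positive couplings and g > 0 satisfies the step-k equation
`1∕gs_k² = 1∕g² + β_{k+1}(gs₀, …, gs_k)`, then the row (k + 1, m, gs₀) of the setting's coupling table coincides with `gs` up to k and ends at g
(forward uniqueness, `FlowStepRuns.flow_eq_of_rgEqH`). [cite: Balaban1987RG1, (0.18)–(0.20) pp.255–256] -/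
theorem extend_run (hD : Definitions S) {k : ℕ} (m : ℕ) {gs : ℕ → ℝ} (hrg : RGEqH k S.β gs)
    (hpos : ∀ j, j ≤ k → 0 < gs j) {g : ℝ} (hg : 0 < g) (heq : 1 / (gs k) ^ 2 = 1 / g ^ 2 + S.β k (prefixOf gs k)) :
    (∀ j, j ≤ k → S.cpl ⟨k + 1, m, gs 0⟩ j = gs j) ∧ S.cpl ⟨k + 1, m, gs 0⟩ (k + 1) = g := by
  set gs' : ℕ → ℝ := fun j => if j ≤ k then gs j else g with hgs'
  have hle : ∀ j, j ≤ k → gs' j = gs j := fun j hj => by simp [hgs', hj]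
  have htop : gs' (k + 1) = g := by simp [hgs']
  have hpre : ∀ j, j ≤ k → prefixOf gs' j = prefixOf gs j := fun j hj => by
    funext i
    simp only [FlowStep.prefixOf_apply]
    exact hle i ((Nat.le_of_lt_succ i.isLt).trans hj)
  have hrg' : RGEqH (k + 1) S.β gs' := by
    intro j hj
    rcases Nat.lt_or_eq_of_le (Nat.le_of_lt_succ hj) with hjk | rfl
    · rw [hle j hjk.le, hle (j + 1) hjk, hpre j hjk.le]; exact hrg j hjk
    · rw [hle j le_rfl, htop, hpre j le_rfl]; exact heq
  have hpos' : ∀ j, j ≤ k + 1 → 0 < gs' j := by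
    intro j hj
    rcases Nat.lt_or_eq_of_le hj with hjk | rfl
    · rw [hle j (Nat.le_of_lt_succ hjk)]; exact hpos j (Nat.le_of_lt_succ hjk)
    · rw [htop]; exact hg
  have h0 : S.cpl ⟨k + 1, m, gs 0⟩ 0 = gs' 0 := by rw [hle 0 (Nat.zero_le _)]; exact hD.d018 ⟨k + 1, m, gs 0⟩
  have key := FlowStepRuns.flow_eq_of_rgEqH ⟨S.cpl ⟨k + 1, m, gs 0⟩, fun _ _ => 0⟩ S.β (k + 1)
    (fun j hj hposj hrhs => by
      obtain ⟨h1, h2⟩ := hD.d020 ⟨k + 1, m, gs 0⟩ j hj hposj hrhs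
      exact ⟨h1, by linarith⟩) h0 hrg' hpos'
  exact ⟨fun j hj => (key j (hj.trans (Nat.le_succ k))).trans (hle j hj), (key (k + 1) le_rfl).trans htop⟩

/-- **A (0.31)-run lies below its endpoint**: `Step.Discrete031 b b′ K g gs` with b ≥ 0 and positive couplings gives `gs j ≤ g` for j ≤ K
(1∕g² ≤ 1∕g² + b(K − j) ≤ 1∕gs_j²). [cite: Balaban1987RG1, Thm 2 (0.31) p.259] -/
theorem le_endpoint_of_discrete031 {b b' g : ℝ} {K : ℕ} {gs : ℕ → ℝ} (hb : 0 ≤ b) (hg : 0 < g)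
    (hD : Step.Discrete031 b b' K g gs) (hpos : ∀ j, j ≤ K → 0 < gs j) {j : ℕ} (hj : j ≤ K) : gs j ≤ g := by
  have h1 := (hD j hj).1
  have hkj : (0 : ℝ) ≤ (K : ℝ) - j := sub_nonneg.2 (by exact_mod_cast hj)
  have h2 : 1 / g ^ 2 ≤ 1 / (gs j) ^ 2 := by nlinarith [mul_nonneg hb hkj]
  have h3 : (gs j) ^ 2 ≤ g ^ 2 := (one_div_le_one_div (pow_pos hg 2) (pow_pos (hpos j hj) 2)).1 h2
  exact (pow_le_pow_iff_left₀ (hpos j hj).le hg.le two_ne_zero).1 h3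

/-! ## §2 Coverage: every small coupling is the step-k coupling of a tuned run of length k + 1, earlier couplings below it -/

/-- **CORE OF THE HISTORY READING.**  Data: Theorem 2's tuned runs at interval γ for every endpoint g ≤ g₁ with per-endpoint constants `B₁ g ≥ 0`, `B₂ g`;
prover 1's binder `hrg` and (U) `β_{k+1} ≤ M` on ]0, γ_U]^{k+1}, γ ≤ γ_U; LOCAL UNIQUENESS (rows (K, m, g₀), (K, m, g₀′) inside ]0, g₂] with the same g_K have
g₀ = g₀′), 0 < g₂ ≤ min(g₁, γ); the printed `Definitions`.  Then for every k and every x ∈ ]0, g₂] with `1∕g₂² + M⁺ ≤ 1∕x²` some row (k + 1, m, g₀) has g_k = x,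
couplings g₀, …, g_k in ]0, x] (BELOW the last), all of it in ]0, g₂], endpoint g ∈ ]0, g₂], and **`B₁ g ≤ β_{k+1}(g₀, …, g_{k−1}, x) ≤ B₂ g`** (tuned run of
length k ending at x → `extend_run` → local uniqueness identifies the extension with the tuned run ending at g → (0.31) on the last window + (0.20)).
[cite: Balaban1987RG1, Thm 2 (0.31) p.259 with (0.18)–(0.20) pp.255–256 and p.298] -/
theorem cover_step (hD : Definitions S) {m : ℕ} {γ γU g₁ g₂ M : ℝ} {B₁ B₂ : ℝ → ℝ}
    (hγU : γ ≤ γU) (hg₂ : 0 < g₂) (hg₂g₁ : g₂ ≤ g₁) (hg₂γ : g₂ ≤ γ)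
    (hrg : ∀ P : B12.RunParams, Step.InInterval γU P.K (S.cpl P) → RGEqH P.K S.β (S.cpl P))
    (hub : BetaUpperH M γU S.β)
    (hT : ∀ g : ℝ, 0 < g → g ≤ g₁ → 0 ≤ B₁ g ∧ ∀ K : ℕ, ∃ g₀ : ℝ, Step.InInterval γ K (S.cpl ⟨K, m, g₀⟩) ∧
      S.cpl ⟨K, m, g₀⟩ K = g ∧ Step.Discrete031 (B₁ g) (B₂ g) K g (S.cpl ⟨K, m, g₀⟩))
    (huniq : ∀ (K : ℕ) (g₀ g₀' : ℝ), Step.InInterval g₂ K (S.cpl ⟨K, m, g₀⟩) → Step.InInterval g₂ K (S.cpl ⟨K, m, g₀'⟩) →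
      S.cpl ⟨K, m, g₀⟩ K = S.cpl ⟨K, m, g₀'⟩ K → g₀ = g₀')
    {k : ℕ} {x : ℝ} (hx : 0 < x) (hxg₂ : x ≤ g₂) (hxA : 1 / g₂ ^ 2 + max M 0 ≤ 1 / x ^ 2) :
    ∃ g₀ g : ℝ, 0 < g ∧ g ≤ g₂ ∧ Step.InInterval x k (S.cpl ⟨k + 1, m, g₀⟩) ∧ S.cpl ⟨k + 1, m, g₀⟩ k = x ∧
      S.cpl ⟨k + 1, m, g₀⟩ (k + 1) = g ∧ Step.InInterval g₂ (k + 1) (S.cpl ⟨k + 1, m, g₀⟩) ∧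
      B₁ g ≤ S.β k (prefixOf (S.cpl ⟨k + 1, m, g₀⟩) k) ∧ S.β k (prefixOf (S.cpl ⟨k + 1, m, g₀⟩) k) ≤ B₂ g := by
  have hxg₁ : x ≤ g₁ := hxg₂.trans hg₂g₁
  obtain ⟨hB₁x, hTx⟩ := hT x hx hxg₁
  obtain ⟨g₀, hI, hend, hDx⟩ := hTx k
  set R := S.cpl ⟨k, m, g₀⟩ with hR
  -- the tuned run of length k ending at x lies below x
  have hRle : ∀ j, j ≤ k → 0 < R j ∧ R j ≤ x := fun j hj =>
    ⟨(hI j hj).1, le_endpoint_of_discrete031 hB₁x hx hDx (fun i hi => (hI i hi).1) hj⟩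
  have hIx : Step.InInterval x k R := fun j hj => hRle j hj
  have hIU : Step.InInterval γU k R := fun j hj => ⟨(hI j hj).1, (hI j hj).2.trans hγU⟩
  have hrgR : RGEqH k S.β R := hrg ⟨k, m, g₀⟩ hIU
  -- the next endpoint
  have hβM : S.β k (prefixOf R k) ≤ M := hub k _ (prefixOf_mem_box_of_inInterval hIU le_rfl)
  set t : ℝ := 1 / x ^ 2 - S.β k (prefixOf R k) with ht
  have htg₂ : 1 / g₂ ^ 2 ≤ t := by
    have : M ≤ max M 0 := le_max_left _ _
    rw [ht]; linarith
  have htpos : 0 < t := lt_of_lt_of_le (by positivity) htg₂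
  set g : ℝ := 1 / Real.sqrt t with hgdef
  have hgpos : 0 < g := by positivity
  have hg2 : 1 / g ^ 2 = t := by rw [hgdef, div_pow, one_pow, Real.sq_sqrt htpos.le, one_div_one_div]
  have hgle : g ≤ g₂ := by
    have h3 : g ^ 2 ≤ g₂ ^ 2 := (one_div_le_one_div (pow_pos hg₂ 2) (pow_pos hgpos 2)).1 (by rw [hg2]; exact htg₂)
    exact (pow_le_pow_iff_left₀ hgpos.le hg₂.le two_ne_zero).1 h3
  have heq : 1 / (R k) ^ 2 = 1 / g ^ 2 + S.β k (prefixOf R k) := by rw [hg2, ht, hend]; ring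
  -- the extension is the row (k+1, m, g₀)
  have hR0 : R 0 = g₀ := hD.d018 ⟨k, m, g₀⟩
  obtain ⟨hEle, hEtop⟩ := extend_run hD m hrgR (fun j hj => (hI j hj).1) hgpos heq
  rw [hR0] at hEle hEtop
  set E := S.cpl ⟨k + 1, m, g₀⟩ with hE
  have hEIx : Step.InInterval x k E := fun j hj => by rw [hEle j hj]; exact hRle j hj
  have hEI : Step.InInterval g₂ (k + 1) E := by
    intro j hj
    rcases Nat.lt_or_eq_of_le hj with hjk | rfl
    · have hjk' : j ≤ k := Nat.le_of_lt_succ hjk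
      rw [hEle j hjk']
      exact ⟨(hRle j hjk').1, (hRle j hjk').2.trans hxg₂⟩
    · rw [hEtop]; exact ⟨hgpos, hgle⟩
  -- the tuned run of length k+1 ending at g, identified with E by local uniqueness
  obtain ⟨hB₁g, hTg⟩ := hT g hgpos (hgle.trans hg₂g₁)
  obtain ⟨g₀', hI', hend', hDg⟩ := hTg (k + 1)
  have hI'g₂ : Step.InInterval g₂ (k + 1) (S.cpl ⟨k + 1, m, g₀'⟩) := fun j hj =>
    ⟨(hI' j hj).1, (le_endpoint_of_discrete031 hB₁g hgpos hDg (fun i hi => (hI' i hi).1) hj).trans hgle⟩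
  obtain rfl : g₀ = g₀' := huniq (k + 1) g₀ g₀' hEI hI'g₂ (hEtop.trans hend'.symm)
  -- (0.31) on the last window + (0.20) at step k
  have hrgE : RGEqH (k + 1) S.β E := hrg ⟨k + 1, m, g₀⟩ fun j hj => ⟨(hEI j hj).1, (hEI j hj).2.trans (hg₂γ.trans hγU)⟩
  have e : 1 / (E k) ^ 2 = 1 / (E (k + 1)) ^ 2 + S.β k (prefixOf E k) := hrgE k (Nat.lt_succ_self k)
  have hw := hDg k (Nat.le_succ k)
  have hone : ((k + 1 : ℕ) : ℝ) - (k : ℝ) = 1 := by push_cast; ring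
  rw [hone, mul_one, mul_one] at hw
  rw [hEtop] at e
  refine ⟨g₀, g, hgpos, hgle, hEIx, ?_, hEtop, hEI, ?_, ?_⟩
  · exact (hEle k le_rfl).trans hend
  · linarith [hw.1]
  · linarith [hw.2]

/-- **COVERAGE, THRESHOLD FORM.**  Under the data of `cover_step` there is x₁ > 0 (x₁ ≤ g₂; explicitly min(g₂, (1∕g₂² + M⁺)^{−1∕2})) such that EVERY
x ∈ ]0, x₁] at EVERY scale k is the step-k coupling of a row (k + 1, m, g₀) inside ]0, g₂] with earlier couplings in ]0, x], endpoint g ∈ ]0, g₂], and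
`B₁ g ≤ β_{k+1}(g₀, …, g_{k−1}, x) ≤ B₂ g` — the last-coordinate projection of the tuned-run curve covers a punctured neighbourhood of zero, in the
HISTORY reading, without the Markov letter. [cite: Balaban1987RG1, Thm 2 (0.31) p.259 with (0.18)–(0.20) pp.255–256 and p.298] -/
theorem cover (hD : Definitions S) {m : ℕ} {γ γU g₁ g₂ M : ℝ} {B₁ B₂ : ℝ → ℝ}
    (hγU : γ ≤ γU) (hg₂ : 0 < g₂) (hg₂g₁ : g₂ ≤ g₁) (hg₂γ : g₂ ≤ γ)
    (hrg : ∀ P : B12.RunParams, Step.InInterval γU P.K (S.cpl P) → RGEqH P.K S.β (S.cpl P))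
    (hub : BetaUpperH M γU S.β)
    (hT : ∀ g : ℝ, 0 < g → g ≤ g₁ → 0 ≤ B₁ g ∧ ∀ K : ℕ, ∃ g₀ : ℝ, Step.InInterval γ K (S.cpl ⟨K, m, g₀⟩) ∧
      S.cpl ⟨K, m, g₀⟩ K = g ∧ Step.Discrete031 (B₁ g) (B₂ g) K g (S.cpl ⟨K, m, g₀⟩))
    (huniq : ∀ (K : ℕ) (g₀ g₀' : ℝ), Step.InInterval g₂ K (S.cpl ⟨K, m, g₀⟩) → Step.InInterval g₂ K (S.cpl ⟨K, m, g₀'⟩) →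
      S.cpl ⟨K, m, g₀⟩ K = S.cpl ⟨K, m, g₀'⟩ K → g₀ = g₀') :
    ∃ x₁ : ℝ, 0 < x₁ ∧ x₁ ≤ g₂ ∧ ∀ (k : ℕ) (x : ℝ), 0 < x → x ≤ x₁ →
      ∃ g₀ g : ℝ, 0 < g ∧ g ≤ g₂ ∧ Step.InInterval x k (S.cpl ⟨k + 1, m, g₀⟩) ∧ S.cpl ⟨k + 1, m, g₀⟩ k = x ∧
        S.cpl ⟨k + 1, m, g₀⟩ (k + 1) = g ∧ Step.InInterval g₂ (k + 1) (S.cpl ⟨k + 1, m, g₀⟩) ∧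
        B₁ g ≤ S.β k (prefixOf (S.cpl ⟨k + 1, m, g₀⟩) k) ∧ S.β k (prefixOf (S.cpl ⟨k + 1, m, g₀⟩) k) ≤ B₂ g := by
  set A : ℝ := 1 / g₂ ^ 2 + max M 0 with hA
  have hApos : 0 < A := by positivity
  set x₁ : ℝ := min g₂ (1 / Real.sqrt A) with hx₁
  have hx₁pos : 0 < x₁ := lt_min hg₂ (by positivity)
  refine ⟨x₁, hx₁pos, min_le_left _ _, fun k x hx hxle => ?_⟩
  have hx2 : x ^ 2 ≤ 1 / A := by
    calc x ^ 2 ≤ (1 / Real.sqrt A) ^ 2 := pow_le_pow_left₀ hx.le (hxle.trans (min_le_right _ _)) 2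
      _ = 1 / A := by rw [div_pow, one_pow, Real.sq_sqrt hApos.le]
  have hxA : A ≤ 1 / x ^ 2 := by rw [le_one_div hApos (by positivity)]; exact hx2
  exact cover_step hD hγU hg₂ hg₂g₁ hg₂γ hrg hub hT huniq hx (hxle.trans (min_le_left _ _)) hxA

/-- **COVERAGE FROM THEOREM 2 AS TYPED** (constants β(g), β′(g) read AT THE ENDPOINT of the covering run, as p. 259's quantifier order allows):
`Theorem2Statement S hL` + `Definitions` + `hrg` and (U) on ]0, γ_U] give γ₁ > 0 such that for every g₂ ∈ ]0, γ₁] on which in-]0, g₂]-interval runs with a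
common endpoint are unique, some x₁ ∈ ]0, g₂] has: every x ∈ ]0, x₁] at every scale k is the step-k coupling of a row (k + 1, m, g₀) with earlier couplings
in ]0, x], endpoint g ∈ ]0, g₂] and `β ln L ≤ β_{k+1}(g₀, …, g_{k−1}, x) ≤ β′ ln L` for Theorem 2's constants 0 < β ≤ β′ at g (selected by `Classical.choose`).
[cite: Balaban1987RG1, Thm 2 (0.31) p.259 with (0.20) p.256] -/
theorem cover_of_theorem2Statement {hL : Odd S.L ∧ 1 < S.L} (hT : Theorem2Statement S hL) (hD : Definitions S) (m : ℕ)
    {γU M : ℝ} (hγU : 0 < γU) (hrg : ∀ P : B12.RunParams, Step.InInterval γU P.K (S.cpl P) → RGEqH P.K S.β (S.cpl P))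
    (hub : BetaUpperH M γU S.β) :
    ∃ γ₁ : ℝ, 0 < γ₁ ∧ γ₁ ≤ γU ∧ ∀ g₂ : ℝ, 0 < g₂ → g₂ ≤ γ₁ →
      (∀ (K : ℕ) (g₀ g₀' : ℝ), Step.InInterval g₂ K (S.cpl ⟨K, m, g₀⟩) → Step.InInterval g₂ K (S.cpl ⟨K, m, g₀'⟩) →
        S.cpl ⟨K, m, g₀⟩ K = S.cpl ⟨K, m, g₀'⟩ K → g₀ = g₀') →
      ∃ x₁ : ℝ, 0 < x₁ ∧ x₁ ≤ g₂ ∧ ∀ (k : ℕ) (x : ℝ), 0 < x → x ≤ x₁ →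
        ∃ g₀ g β β' : ℝ, 0 < g ∧ g ≤ g₂ ∧ 0 < β ∧ β ≤ β' ∧ Step.InInterval x k (S.cpl ⟨k + 1, m, g₀⟩) ∧
          S.cpl ⟨k + 1, m, g₀⟩ k = x ∧ S.cpl ⟨k + 1, m, g₀⟩ (k + 1) = g ∧
          β * Real.log S.L ≤ S.β k (prefixOf (S.cpl ⟨k + 1, m, g₀⟩) k) ∧
          S.β k (prefixOf (S.cpl ⟨k + 1, m, g₀⟩) k) ≤ β' * Real.log S.L := by
  classical
  have hlog : 0 < Real.log (S.L : ℝ) := Real.log_pos (by exact_mod_cast hL.2)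
  obtain ⟨γ₀, hγ₀, hγ⟩ := tunedRuns_of_theorem2Statement hT m
  set γ := min γU γ₀ with hγdef
  have hγpos : 0 < γ := lt_min hγU hγ₀
  obtain ⟨g₁, hg₁, hg⟩ := hγ γ hγpos (min_le_right _ _)
  have hex : ∀ g : ℝ, ∃ c : ℝ × ℝ, 0 < g → g ≤ g₁ → 0 < c.1 ∧ c.1 ≤ c.2 ∧ ∀ K : ℕ, ∃ g₀ : ℝ,
      Step.InInterval γ K (S.cpl ⟨K, m, g₀⟩) ∧ S.cpl ⟨K, m, g₀⟩ K = g ∧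
        Step.Discrete031 (c.1 * Real.log S.L) (c.2 * Real.log S.L) K g (S.cpl ⟨K, m, g₀⟩) := by
    intro g
    by_cases h : 0 < g ∧ g ≤ g₁
    · obtain ⟨β, β', hβ, hββ', hK⟩ := hg g h.1 h.2
      exact ⟨(β, β'), fun _ _ => ⟨hβ, hββ', hK⟩⟩
    · exact ⟨(1, 1), fun h1 h2 => absurd ⟨h1, h2⟩ h⟩
  choose c hc using hex
  refine ⟨min g₁ γ, lt_min hg₁ hγpos, (min_le_right _ _).trans (min_le_left _ _), fun g₂ hg₂ hg₂le huniq => ?_⟩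
  have hT' : ∀ g : ℝ, 0 < g → g ≤ g₁ → 0 ≤ (c g).1 * Real.log S.L ∧ ∀ K : ℕ, ∃ g₀ : ℝ,
      Step.InInterval γ K (S.cpl ⟨K, m, g₀⟩) ∧ S.cpl ⟨K, m, g₀⟩ K = g ∧
        Step.Discrete031 ((c g).1 * Real.log S.L) ((c g).2 * Real.log S.L) K g (S.cpl ⟨K, m, g₀⟩) :=
    fun g h1 h2 => ⟨(mul_pos (hc g h1 h2).1 hlog).le, (hc g h1 h2).2.2⟩
  obtain ⟨x₁, hx₁, hx₁g₂, hcov⟩ := cover hD (B₁ := fun g => (c g).1 * Real.log S.L) (B₂ := fun g => (c g).2 * Real.log S.L)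
    (min_le_left γU γ₀) hg₂ (hg₂le.trans (min_le_left _ _)) (hg₂le.trans (min_le_right _ _)) hrg hub hT' huniq
  refine ⟨x₁, hx₁, hx₁g₂, fun k x hx hxle => ?_⟩
  obtain ⟨g₀, g, hgpos, hgle, hIx, hk, hend, -, hlo, hhi⟩ := hcov k x hx hxle
  have hcg := hc g hgpos (hgle.trans (hg₂le.trans (min_le_left _ _)))
  exact ⟨g₀, g, (c g).1, (c g).2, hgpos, hgle, hcg.1, hcg.2.1, hIx, hk, hend, hlo, hhi⟩

/-! ## §3 From the run curve to the box: the coupling-chart oscillation letter -/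

/-- **THE WINDOW BOUND SPREADS OVER THE BOX AT THE PRICE Λδ.**  If every x ∈ ]0, x₁] at every scale is the step-k coupling of a row (k + 1, m, g₀) with
earlier couplings in ]0, x] and `b ≤ β_{k+1}(g₀, …, g_{k−1}, x) ≤ b′` (§2 with uniform constants), and on the box ]0, δ]^{k+1}, δ ≤ x₁, the value of β_{k+1}
moves by at most Λδ when the PRECEDING couplings are changed inside ]0, δ] (the oscillation letter `hosc` at δ — the history dependence of p. 298 in
the COUPLING chart), then `BetaLowerH (b − Λδ) δ S.β ∧ BetaUpperH (b′ + Λδ) δ S.β`. [cite: Balaban1987RG1, Thm 2 (0.31) p.259 with p.298] -/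
theorem letters_of_cover_histOsc {m : ℕ} {b b' Λ x₁ δ : ℝ}
    (hosc : ∀ (k : ℕ) (p q : Fin (k + 1) → ℝ), p ∈ Box δ k → q ∈ Box δ k → p (Fin.last k) = q (Fin.last k) →
      |S.β k p - S.β k q| ≤ Λ * δ)
    (hcov : ∀ (k : ℕ) (x : ℝ), 0 < x → x ≤ x₁ → ∃ g₀ : ℝ, Step.InInterval x k (S.cpl ⟨k + 1, m, g₀⟩) ∧
      S.cpl ⟨k + 1, m, g₀⟩ k = x ∧ b ≤ S.β k (prefixOf (S.cpl ⟨k + 1, m, g₀⟩) k) ∧ S.β k (prefixOf (S.cpl ⟨k + 1, m, g₀⟩) k) ≤ b')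
    (hδx : δ ≤ x₁) : BetaLowerH (b - Λ * δ) δ S.β ∧ BetaUpperH (b' + Λ * δ) δ S.β := by
  have key : ∀ (k : ℕ) (v : Fin (k + 1) → ℝ), v ∈ Box δ k → b - Λ * δ ≤ S.β k v ∧ S.β k v ≤ b' + Λ * δ := by
    intro k v hv
    have hlast := (mem_box.1 hv) (Fin.last k)
    obtain ⟨g₀, hIx, hk, hlo, hhi⟩ := hcov k (v (Fin.last k)) hlast.1 (hlast.2.trans hδx)
    set p := prefixOf (S.cpl ⟨k + 1, m, g₀⟩) k with hp
    have hpbox : p ∈ Box δ k := box_mono hlast.2 k (prefixOf_mem_box_of_inInterval hIx le_rfl)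
    have hplast : v (Fin.last k) = p (Fin.last k) := by rw [hp, FlowStep.prefixOf_apply, Fin.val_last, hk]
    have h := abs_sub_le_iff.1 (hosc k v p hv hpbox hplast); constructor <;> linarith [h.1, h.2]
  exact ⟨fun k v hv => (key k v hv).1, fun k v hv => (key k v hv).2⟩

/-! ## §4 The AF letter from the g-uniform Theorem 2 in the history reading; the Markov case Λ = 0 -/

/-- **THE TWO-SIDED POINTWISE LETTERS FROM THE g-UNIFORM THEOREM 2, HISTORY READING.**  `hTu` (part 2's reading: «there exist constants β, β′» before
«for a sufficiently small positive g») + `Definitions` + `hrg` and (U) on ]0, γ_U] + the oscillation letter `hosc` on every box ]0, δ]^{k+1}, δ ≤ γ_U + LOCAL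
UNIQUENESS on SOME ]0, g₂] ⟹ x₁ > 0 and Theorem 2's 0 < β ≤ β′ with **`BetaLowerH (β ln L − Λδ) δ S.β ∧ BetaUpperH (β′ ln L + Λδ) δ S.β` for every δ ∈ ]0, x₁]**.
No Markov letter, no injectivity. [cite: Balaban1987RG1, Thm 2 (0.31) p.259 with (0.18)–(0.20) pp.255–256 and p.298] -/
theorem letters_of_uniformTheorem2_unique_histOsc (hD : Definitions S)
    (hTu : ∀ m : ℕ, ∃ γ₀ : ℝ, 0 < γ₀ ∧ ∀ γ : ℝ, 0 < γ → γ ≤ γ₀ → ∃ g₁ : ℝ, 0 < g₁ ∧ ∃ β β' : ℝ, 0 < β ∧ β ≤ β' ∧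
      ∀ g : ℝ, 0 < g → g ≤ g₁ → ∀ K : ℕ, ∃ g₀ : ℝ, Step.InInterval γ K (S.cpl ⟨K, m, g₀⟩) ∧ S.cpl ⟨K, m, g₀⟩ K = g ∧
        Step.Discrete031 (β * Real.log S.L) (β' * Real.log S.L) K g (S.cpl ⟨K, m, g₀⟩))
    (m : ℕ) (hL1 : 1 < S.L) {γU M Λ : ℝ} (hγU : 0 < γU)
    (hrg : ∀ P : B12.RunParams, Step.InInterval γU P.K (S.cpl P) → RGEqH P.K S.β (S.cpl P))
    (hub : BetaUpperH M γU S.β)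
    (hosc : ∀ δ : ℝ, 0 < δ → δ ≤ γU → ∀ (k : ℕ) (p q : Fin (k + 1) → ℝ), p ∈ Box δ k → q ∈ Box δ k →
      p (Fin.last k) = q (Fin.last k) → |S.β k p - S.β k q| ≤ Λ * δ)
    (huniq : ∃ g₂ : ℝ, 0 < g₂ ∧ ∀ (K : ℕ) (g₀ g₀' : ℝ), Step.InInterval g₂ K (S.cpl ⟨K, m, g₀⟩) →
      Step.InInterval g₂ K (S.cpl ⟨K, m, g₀'⟩) → S.cpl ⟨K, m, g₀⟩ K = S.cpl ⟨K, m, g₀'⟩ K → g₀ = g₀') :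
    ∃ x₁ β β' : ℝ, 0 < x₁ ∧ x₁ ≤ γU ∧ 0 < β ∧ β ≤ β' ∧ ∀ δ : ℝ, 0 < δ → δ ≤ x₁ →
      BetaLowerH (β * Real.log S.L - Λ * δ) δ S.β ∧ BetaUpperH (β' * Real.log S.L + Λ * δ) δ S.β := by
  have hlog : 0 < Real.log (S.L : ℝ) := Real.log_pos (by exact_mod_cast hL1)
  obtain ⟨γ₀, hγ₀, hγ⟩ := hTu m
  set γ := min γU γ₀ with hγdef
  have hγpos : 0 < γ := lt_min hγU hγ₀
  obtain ⟨g₁, hg₁, β, β', hβ, hββ', hg⟩ := hγ γ hγpos (min_le_right _ _)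
  obtain ⟨g₂, hg₂, hU⟩ := huniq
  set g₃ := min g₂ (min g₁ γ) with hg₃
  have hg₃pos : 0 < g₃ := lt_min hg₂ (lt_min hg₁ hγpos)
  have hU₃ : ∀ (K : ℕ) (g₀ g₀' : ℝ), Step.InInterval g₃ K (S.cpl ⟨K, m, g₀⟩) → Step.InInterval g₃ K (S.cpl ⟨K, m, g₀'⟩) →
      S.cpl ⟨K, m, g₀⟩ K = S.cpl ⟨K, m, g₀'⟩ K → g₀ = g₀' :=
    fun K g₀ g₀' hI hI' he => hU K g₀ g₀' (fun i hi => ⟨(hI i hi).1, (hI i hi).2.trans (min_le_left _ _)⟩)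
      (fun i hi => ⟨(hI' i hi).1, (hI' i hi).2.trans (min_le_left _ _)⟩) he
  have hT' : ∀ g : ℝ, 0 < g → g ≤ g₁ → 0 ≤ (fun _ : ℝ => β * Real.log S.L) g ∧ ∀ K : ℕ, ∃ g₀ : ℝ,
      Step.InInterval γ K (S.cpl ⟨K, m, g₀⟩) ∧ S.cpl ⟨K, m, g₀⟩ K = g ∧
        Step.Discrete031 ((fun _ : ℝ => β * Real.log S.L) g) ((fun _ : ℝ => β' * Real.log S.L) g) K g (S.cpl ⟨K, m, g₀⟩) :=
    fun g h1 h2 => ⟨(mul_pos hβ hlog).le, hg g h1 h2⟩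
  obtain ⟨x₁, hx₁, hx₁g₃, hcov⟩ := cover hD (min_le_left γU γ₀) hg₃pos ((min_le_right _ _).trans (min_le_left _ _))
    ((min_le_right _ _).trans (min_le_right _ _)) hrg hub hT' hU₃
  have hx₁U : x₁ ≤ γU := hx₁g₃.trans (((min_le_right _ _).trans (min_le_right _ _)).trans (min_le_left _ _))
  refine ⟨x₁, β, β', hx₁, hx₁U, hβ, hββ', fun δ hδ hδx => ?_⟩
  exact letters_of_cover_histOsc (hosc δ hδ (hδx.trans hx₁U))
    (fun k x hx hxle => by
      obtain ⟨g₀, g, -, -, hIx, hk, -, -, hlo, hhi⟩ := hcov k x hx hxle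
      exact ⟨g₀, hIx, hk, hlo, hhi⟩) hδx

/-- **THE AF LETTER `FlowStep.BetaAFH` IS NECESSARY, HISTORY READING**: under the letters of `letters_of_uniformTheorem2_unique_histOsc` with Λ ≥ 0,
`BetaAFH S.β` — on the box ]0, δ]^{k+1} with δ = min(x₁, β ln L∕(2(Λ + 1))) the lower constant β ln L − Λδ is positive.  The gen-42 question «does a
sign-free history modulus let Theorem 2 force positivity on a NEIGHBOURHOOD of the run curve?» — YES, on whole boxes, for a COUPLING-chart modulus,
given local uniqueness (which part 6 derives from prover 1's fading-memory moduli). [cite: Balaban1987RG1, Thm 2 (0.31) p.259 with p.298] -/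
theorem betaAFH_of_uniformTheorem2_unique_histOsc (hD : Definitions S)
    (hTu : ∀ m : ℕ, ∃ γ₀ : ℝ, 0 < γ₀ ∧ ∀ γ : ℝ, 0 < γ → γ ≤ γ₀ → ∃ g₁ : ℝ, 0 < g₁ ∧ ∃ β β' : ℝ, 0 < β ∧ β ≤ β' ∧
      ∀ g : ℝ, 0 < g → g ≤ g₁ → ∀ K : ℕ, ∃ g₀ : ℝ, Step.InInterval γ K (S.cpl ⟨K, m, g₀⟩) ∧ S.cpl ⟨K, m, g₀⟩ K = g ∧
        Step.Discrete031 (β * Real.log S.L) (β' * Real.log S.L) K g (S.cpl ⟨K, m, g₀⟩))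
    (m : ℕ) (hL1 : 1 < S.L) {γU M Λ : ℝ} (hγU : 0 < γU) (hΛ : 0 ≤ Λ)
    (hrg : ∀ P : B12.RunParams, Step.InInterval γU P.K (S.cpl P) → RGEqH P.K S.β (S.cpl P))
    (hub : BetaUpperH M γU S.β)
    (hosc : ∀ δ : ℝ, 0 < δ → δ ≤ γU → ∀ (k : ℕ) (p q : Fin (k + 1) → ℝ), p ∈ Box δ k → q ∈ Box δ k →
      p (Fin.last k) = q (Fin.last k) → |S.β k p - S.β k q| ≤ Λ * δ)
    (huniq : ∃ g₂ : ℝ, 0 < g₂ ∧ ∀ (K : ℕ) (g₀ g₀' : ℝ), Step.InInterval g₂ K (S.cpl ⟨K, m, g₀⟩) →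
      Step.InInterval g₂ K (S.cpl ⟨K, m, g₀'⟩) → S.cpl ⟨K, m, g₀⟩ K = S.cpl ⟨K, m, g₀'⟩ K → g₀ = g₀') : BetaAFH S.β := by
  obtain ⟨x₁, β, β', hx₁, -, hβ, -, h⟩ := letters_of_uniformTheorem2_unique_histOsc hD hTu m hL1 hγU hrg hub hosc huniq
  have hlog : 0 < Real.log (S.L : ℝ) := Real.log_pos (by exact_mod_cast hL1)
  have hb : 0 < β * Real.log S.L := mul_pos hβ hlog
  set δ : ℝ := min x₁ (β * Real.log S.L / (2 * (Λ + 1))) with hδ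
  have hδpos : 0 < δ := lt_min hx₁ (by positivity)
  refine ⟨δ, hδpos, β * Real.log S.L - Λ * δ, ?_, (h δ hδpos (min_le_left _ _)).1⟩
  have h1 : Λ * δ ≤ Λ * (β * Real.log S.L / (2 * (Λ + 1))) := mul_le_mul_of_nonneg_left (min_le_right _ _) hΛ
  have h2 : Λ * (β * Real.log S.L / (2 * (Λ + 1))) < β * Real.log S.L := by
    rw [mul_div_assoc', div_lt_iff₀ (by positivity)]
    nlinarith
  linarith

/-- The Markov letter `hM` (β_{k+1} reads g_k only) IS the oscillation letter with Λ = 0. [folklore] -/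
theorem histOsc_of_markov (hM : ∀ (k : ℕ) (p q : Fin (k + 1) → ℝ), p (Fin.last k) = q (Fin.last k) → S.β k p = S.β k q)
    (δ : ℝ) (k : ℕ) (p q : Fin (k + 1) → ℝ) (_hp : p ∈ Box δ k) (_hq : q ∈ Box δ k) (h : p (Fin.last k) = q (Fin.last k)) :
    |S.β k p - S.β k q| ≤ 0 * δ := by
  rw [hM k p q h, sub_self, abs_zero, zero_mul]

/-- **PART 2's `letters_of_uniformTheorem2_markov` WITH INJECTIVITY WEAKENED TO LOCAL UNIQUENESS**: `hTu` + `Definitions` + Markov + (U) + `hrg` + unique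
in-interval runs inside SOME ]0, g₂] ⟹ `BetaLowerH (β ln L) x₁ S.β ∧ BetaUpperH (β′ ln L) x₁ S.β` on some x₁ > 0 (part 1 §2: injective one-step maps on ]0, γ_U]
imply uniqueness of in-]0, γ_U]-interval runs, a fortiori the local letter). [cite: Balaban1987RG1, Thm 2 (0.31) p.259 with (0.20) p.256] -/
theorem letters_of_uniformTheorem2_unique_markov (hD : Definitions S)
    (hTu : ∀ m : ℕ, ∃ γ₀ : ℝ, 0 < γ₀ ∧ ∀ γ : ℝ, 0 < γ → γ ≤ γ₀ → ∃ g₁ : ℝ, 0 < g₁ ∧ ∃ β β' : ℝ, 0 < β ∧ β ≤ β' ∧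
      ∀ g : ℝ, 0 < g → g ≤ g₁ → ∀ K : ℕ, ∃ g₀ : ℝ, Step.InInterval γ K (S.cpl ⟨K, m, g₀⟩) ∧ S.cpl ⟨K, m, g₀⟩ K = g ∧
        Step.Discrete031 (β * Real.log S.L) (β' * Real.log S.L) K g (S.cpl ⟨K, m, g₀⟩))
    (m : ℕ) (hL1 : 1 < S.L) (hM : ∀ (k : ℕ) (p q : Fin (k + 1) → ℝ), p (Fin.last k) = q (Fin.last k) → S.β k p = S.β k q)
    {γU M : ℝ} (hγU : 0 < γU) (hrg : ∀ P : B12.RunParams, Step.InInterval γU P.K (S.cpl P) → RGEqH P.K S.β (S.cpl P))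
    (hub : BetaUpperH M γU S.β)
    (huniq : ∃ g₂ : ℝ, 0 < g₂ ∧ ∀ (K : ℕ) (g₀ g₀' : ℝ), Step.InInterval g₂ K (S.cpl ⟨K, m, g₀⟩) →
      Step.InInterval g₂ K (S.cpl ⟨K, m, g₀'⟩) → S.cpl ⟨K, m, g₀⟩ K = S.cpl ⟨K, m, g₀'⟩ K → g₀ = g₀') :
    ∃ x₁ β β' : ℝ, 0 < x₁ ∧ x₁ ≤ γU ∧ 0 < β ∧ β ≤ β' ∧
      BetaLowerH (β * Real.log S.L) x₁ S.β ∧ BetaUpperH (β' * Real.log S.L) x₁ S.β := by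
  obtain ⟨x₁, β, β', hx₁, hx₁U, hβ, hββ', h⟩ := letters_of_uniformTheorem2_unique_histOsc hD hTu m hL1 hγU hrg hub
    (fun δ _ _ k p q hp hq hl => histOsc_of_markov hM δ k p q hp hq hl) huniq
  have h1 := h x₁ hx₁ le_rfl
  simp only [zero_mul, sub_zero, add_zero] at h1
  exact ⟨x₁, β, β', hx₁, hx₁U, hβ, hββ', h1.1, h1.2⟩

/-- **PART 1's `betaSignH_of_theorem2_markov` WITH INJECTIVITY WEAKENED TO LOCAL UNIQUENESS** (Theorem 2 AS TYPED): `Theorem2Statement S hL` + `Definitions` +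
Markov + (U) + `hrg` + unique in-interval runs inside some ]0, g₂] ⟹ `BetaSignH S.β` (indeed β_{k+1} ≥ β(g) ln L > 0 on ]0, x₁]^{k+1}, constants at the endpoint
g = g(k, x) of the covering run). [cite: Balaban1987RG1, Thm 2 (0.31) p.259 with (0.20) p.256] -/
theorem betaSignH_of_theorem2_unique_markov {hL : Odd S.L ∧ 1 < S.L} (hT : Theorem2Statement S hL) (hD : Definitions S) (m : ℕ)
    (hM : ∀ (k : ℕ) (p q : Fin (k + 1) → ℝ), p (Fin.last k) = q (Fin.last k) → S.β k p = S.β k q)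
    {γU M : ℝ} (hγU : 0 < γU) (hrg : ∀ P : B12.RunParams, Step.InInterval γU P.K (S.cpl P) → RGEqH P.K S.β (S.cpl P))
    (hub : BetaUpperH M γU S.β)
    (huniq : ∃ g₂ : ℝ, 0 < g₂ ∧ ∀ (K : ℕ) (g₀ g₀' : ℝ), Step.InInterval g₂ K (S.cpl ⟨K, m, g₀⟩) →
      Step.InInterval g₂ K (S.cpl ⟨K, m, g₀'⟩) → S.cpl ⟨K, m, g₀⟩ K = S.cpl ⟨K, m, g₀'⟩ K → g₀ = g₀') : BetaSignH S.β := by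
  have hlog : 0 < Real.log (S.L : ℝ) := Real.log_pos (by exact_mod_cast hL.2)
  obtain ⟨γ₁, hγ₁, -, hcov⟩ := cover_of_theorem2Statement hT hD m hγU hrg hub
  obtain ⟨g₂, hg₂, hU⟩ := huniq
  set g₃ := min g₂ γ₁ with hg₃
  have hU₃ : ∀ (K : ℕ) (g₀ g₀' : ℝ), Step.InInterval g₃ K (S.cpl ⟨K, m, g₀⟩) → Step.InInterval g₃ K (S.cpl ⟨K, m, g₀'⟩) →
      S.cpl ⟨K, m, g₀⟩ K = S.cpl ⟨K, m, g₀'⟩ K → g₀ = g₀' :=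
    fun K g₀ g₀' hI hI' he => hU K g₀ g₀' (fun i hi => ⟨(hI i hi).1, (hI i hi).2.trans (min_le_left _ _)⟩)
      (fun i hi => ⟨(hI' i hi).1, (hI' i hi).2.trans (min_le_left _ _)⟩) he
  obtain ⟨x₁, hx₁, -, h⟩ := hcov g₃ (lt_min hg₂ hγ₁) (min_le_right _ _) hU₃
  refine ⟨x₁, hx₁, fun k v hv => ?_⟩
  have hlast := (mem_box.1 hv) (Fin.last k)
  obtain ⟨g₀, g, β, β', -, -, hβ, -, -, hk, -, hlo, -⟩ := h k (v (Fin.last k)) hlast.1 hlast.2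
  have he : S.β k v = S.β k (prefixOf (S.cpl ⟨k + 1, m, g₀⟩) k) :=
    hM k _ _ (by rw [FlowStep.prefixOf_apply, Fin.val_last, hk])
  rw [he]
  exact le_trans (mul_pos hβ hlog).le hlo

end

end Summit.QuantumFields.BalabanUV.Beta.EriceFlowEnclosureB12AsPrintedPointwiseCover
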